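import Mathlib.Analysis.Normed.Operator.LinearIsometry
import Mathlib.Analysis.SpecialFunctions.Pow.Real
import Literature.Analysis.FluidPDE.ClassicalSolution
import Literature.Analysis.FluidPDE.LerayHopf
import Literature.Analysis.FluidPDE.MildSolution
import HarnessLib

-- provenance: harness21/H21/H21/Prelude/FluidKinetic/SelfSimilar.lean @ ce4a7be (interim HEAD d8f2665); M5 mechanical rewrite
/-!
# Navier–Stokes scaling, self-similar profiles, ancient solutions and Type I bounds

Trunk: FluidKinetic (outline `H21/Outlines/FluidKinetic.md`, item F10 `SelfSimilar`; notion
`scaling_selfsimilar_ancient`).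

Let `E` be a finite-dimensional real inner product space (physical space; `E = ℝ³` in the
literature). The Navier–Stokes system `∂ₜu + (u·∇)u = νΔu − ∇p + f`, `div u = 0` is invariant
under the **parabolic scaling** `u ↦ u_λ`, `u_λ(t, x) = λ u(λ²t, λx)`,
`p_λ(t, x) = λ² p(λ²t, λx)`, `f_λ(t, x) = λ³ f(λ²t, λx)` (Leray 1934, §20; Caffarelli–Kohn–Nirenberg
1982, §1; Koch–Tataru 2001, §1). This file provides

* the scaling maps `Literature.Analysis.FluidPDE.nsRescale`, `nsRescalePressure`, `nsRescaleForce`, `nsRescaleData`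
  and their group law;
* Leray's backward self-similar ansatz `u(t, x) = (2a(T−t))^{-1/2} U(x / √(2a(T−t)))`
  (`Literature.Analysis.FluidPDE.lerayBackward`, Leray 1934, (3.11)–(3.12); Nečas–Růžička–Šverák 1996, (1.3)–(1.5))
  and the profile system `−νΔU + aU + a(y·∇)U + (U·∇)U + ∇P = 0`, `div U = 0`
  (`Literature.Analysis.FluidPDE.IsLerayProfile`); the forward (expanding) twins `lerayForward`,
  `IsForwardProfile`;
* (discrete, rotated) self-similarity `IsSelfSimilar`, `IsDiscretelySelfSimilar`,
  `IsRotatedDSS` (Chae–Wolf 2017, Def. 1.1);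
* ancient mild solutions on `(-∞, 0) × E` (`IsAncientMildSolution`,
  `IsBoundedAncientMildSolution`; Koch–Nadirashvili–Seregin–Šverák 2009, §1;
  Seregin–Šverák 2009, §1) and the Type I decay bounds `HasTypeIDecay`, `HasTypeITimeDecay`.

## Hand-over from G03 (`Statements/NS/CriticalSpaces`)

For `F = E`, `Fluid.nsRescale c u` and `Fluid.nsRescaleData c u₀` are **letter for letter** the
accepted `NS.rescale c u := fun t x => c • u (c ^ 2 * t) (c • x)` and
`NS.rescaleData c u₀ := fun x => c • u₀ (c • x)` (Statements/NS/CriticalSpaces), so that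
`NS.rescale c u = Fluid.nsRescale c u` holds by `rfl`. Per the import policy this prelude file
does not import the statement file; the `rfl` bridge `NS.rescale_eq_nsRescale` is stated in
`Statements/NS/CriticalRegularity.lean`, which imports both.

## Mathlib search

Mathlib (this pin) has no Navier–Stokes scaling, self-similar profile, ancient solution or Type I
notion (searched `selfSimilar`, `self-similar`, `rescale`, `ancient`, `NavierStokes`: nothing
relevant). Used from Mathlib: `LinearIsometryEquiv` (`E ≃ₗᵢ[ℝ] E`), `Real.sqrt`, `fderiv`,
`gradient`, `InnerProductSpace.laplacian` (`Δ`), `eLpNorm`, `Module.finrank`. From H21: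
`Fluid.IsDivFree`, `Fluid.convect` (F1), `Fluid.IsClassicalNSSolutionOn` (F2),
`Fluid.IsLerayHopfOn` (F5), `Fluid.IsMildNSSolutionBetween`, `Fluid.IsBoundedOn`,
`Fluid.IsWeaklyDivFree` (F8/F1).

## Design notes

* The scaling maps are total in `c : ℝ` (no positivity), as is `NS.rescale`; the group law
  `nsRescale_mul` then holds for all `c d : ℝ`. Statements about solutions take `0 < c`.
* `lerayBackward a T U t` is meaningful for `t < T` (and `0 < a`); for `t ≥ T` (or `a ≤ 0`)
  `Real.sqrt` of a nonpositive number is `0` and `0⁻¹ = 0`, so the value is the **junk value**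
  `0 • U 0 = 0`. Dually `lerayForward a U t` is junk (`= 0`) for `t ≤ 0`.
* The profile systems are pointwise identities for `C²` profiles (`ContDiff ℝ 2 U`,
  `ContDiff ℝ 1 P`), the regularity in which NRŠ and Tsai state them; weak `L³`/`H¹_loc`
  profiles are smooth by elliptic regularity (NRŠ 1996, §2), which is not formalised here.
* `IsAncientMildSolution` quantifies the two-time duality identity over `s < t < 0` (strict, as in
  KNSS 2009, (1.3)); with the `heatFlow` device of `MildSolution` the identity at `s = t` is a
  tautology anyway (`IsMildNSSolutionBetween.refl`).
* The rescaled time set of a classical solution on `S` is the preimage `(c ^ 2 * ·) ⁻¹' S`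
  (`= c⁻² S`), which keeps `timeDerivWithin` one-sided at the rescaled endpoints.

## References

* J. Leray, *Sur le mouvement d'un liquide visqueux emplissant l'espace*, Acta Math. 63 (1934),
  §20 (scaling), (3.11)–(3.12) (backward self-similar ansatz).
* J. Nečas, M. Růžička, V. Šverák, *On Leray's self-similar solutions of the Navier–Stokes
  equations*, Acta Math. 176 (1996), (1.3)–(1.5), Thm. 1.
* T.-P. Tsai, *On Leray's self-similar solutions of the Navier–Stokes equations satisfying local
  energy estimates*, ARMA 143 (1998), Thm. 1.
* G. Koch, N. Nadirashvili, G. Seregin, V. Šverák, *Liouville theorems for the Navier–Stokes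
  equations and applications*, Acta Math. 203 (2009), §1, (1.3)–(1.6).
* G. Seregin, V. Šverák, *On Type I singularities of the local axi-symmetric solutions of the
  Navier–Stokes equations*, Comm. PDE 34 (2009), §1.
* D. Chae, J. Wolf, *Existence of discretely self-similar solutions to the Navier–Stokes
  equations for initial value in `L²_loc(ℝ³)`*, Ann. Inst. H. Poincaré Anal. Non Linéaire 35
  (2018; arXiv 2017), Def. 1.1 ((rotated) `λ`-DSS).
* H. Jia, V. Šverák, *Local-in-space estimates near initial time for weak solutions of the
  Navier–Stokes equations and forward self-similar solutions*, Invent. Math. 196 (2014), §1.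
* H. Koch, D. Tataru, *Well-posedness for the Navier–Stokes equations*, Adv. Math. 157 (2001), §1.
-/

noncomputable section

open MeasureTheory Set Function Filter Topology
open scoped ContDiff Laplacian InnerProductSpace RealInnerProductSpace ENNReal NNReal

namespace Literature.Analysis.FluidPDE

/-! ### Parabolic scaling -/

section Rescale

variable {E : Type*} [NormedAddCommGroup E] [NormedSpace ℝ E]
variable {F : Type*} [NormedAddCommGroup F] [NormedSpace ℝ F]

/-- The **Navier–Stokes (parabolic) rescaling** of a space–time field `u : ℝ → E → F` (time
first) by `c : ℝ`: `(nsRescale c u) t x = c • u (c² t) (c x)` (Leray 1934, §20;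
Koch–Tataru 2001, §1). For `F = E` this is letter for letter the accepted `Literature.Analysis.FluidPDE.rescale`
(bridge `NS.rescale_eq_nsRescale : NS.rescale c u = Fluid.nsRescale c u := rfl` in
`Statements/NS/CriticalRegularity`). If `(u, p)` solves Navier–Stokes with force `f`, then
`(nsRescale c u, nsRescalePressure c p)` solves it with force `nsRescaleForce c f`, `0 < c`. [cite: Leray1934, §20] -/
def nsRescale (c : ℝ) (u : ℝ → E → F) : ℝ → E → F := fun t x => c • u (c ^ 2 * t) (c • x)

/-- The rescaling of a **pressure** `p : ℝ → E → ℝ` by `c : ℝ`: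
`(nsRescalePressure c p) t x = c² p (c² t) (c x)` (Leray 1934, §20; Caffarelli–Kohn–Nirenberg
1982, (1.6)). [cite: Leray1934, §20] -/
def nsRescalePressure (c : ℝ) (p : ℝ → E → ℝ) : ℝ → E → ℝ := fun t x => c ^ 2 * p (c ^ 2 * t) (c • x)

/-- The rescaling of a **force** `f : ℝ → E → F` by `c : ℝ`:
`(nsRescaleForce c f) t x = c³ • f (c² t) (c x)` (Caffarelli–Kohn–Nirenberg 1982, (1.6)). [cite: CaffarelliKohnNirenberg1982, (1.6] -/
def nsRescaleForce (c : ℝ) (f : ℝ → E → F) : ℝ → E → F := fun t x => c ^ 3 • f (c ^ 2 * t) (c • x)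

/-- The rescaling of **initial data** `u₀ : E → F` by `c : ℝ`: `(nsRescaleData c u₀) x = c • u₀ (c x)`,
the time-zero slice of `nsRescale` (`nsRescale_zero_time`). For `F = E` letter for letter the
accepted `Literature.Analysis.FluidPDE.rescaleData` (Koch–Tataru 2001, §1). [cite: KochTataru2001, §1] -/
def nsRescaleData (c : ℝ) (u₀ : E → F) : E → F := fun x => c • u₀ (c • x)

/-- Unfolding `nsRescale` (Leray 1934, §20). [cite: Leray1934, §20] -/
@[simp]
theorem nsRescale_apply (c : ℝ) (u : ℝ → E → F) (t : ℝ) (x : E) :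
    nsRescale c u t x = c • u (c ^ 2 * t) (c • x) :=
  rfl

/-- Unfolding `nsRescalePressure` (Leray 1934, §20). [cite: Leray1934, §20] -/
@[simp]
theorem nsRescalePressure_apply (c : ℝ) (p : ℝ → E → ℝ) (t : ℝ) (x : E) :
    nsRescalePressure c p t x = c ^ 2 * p (c ^ 2 * t) (c • x) :=
  rfl

/-- Unfolding `nsRescaleForce` (Caffarelli–Kohn–Nirenberg 1982, (1.6)). [cite: CaffarelliKohnNirenberg1982, (1.6] -/
@[simp]
theorem nsRescaleForce_apply (c : ℝ) (f : ℝ → E → F) (t : ℝ) (x : E) :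
    nsRescaleForce c f t x = c ^ 3 • f (c ^ 2 * t) (c • x) :=
  rfl

/-- Unfolding `nsRescaleData` (Koch–Tataru 2001, §1). [cite: KochTataru2001, §1] -/
@[simp]
theorem nsRescaleData_apply (c : ℝ) (u₀ : E → F) (x : E) :
    nsRescaleData c u₀ x = c • u₀ (c • x) :=
  rfl

/-- The time-zero slice of the rescaled field is the rescaled datum (Koch–Tataru 2001, §1). [cite: KochTataru2001, §1] -/
@[simp]
theorem nsRescale_zero_time (c : ℝ) (u : ℝ → E → F) : nsRescale c u 0 = nsRescaleData c (u 0) := by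
  funext x
  simp

/-- Rescaling by `1` is the identity (Leray 1934, §20). [cite: Leray1934, §20] -/
@[simp]
theorem nsRescale_one (u : ℝ → E → F) : nsRescale 1 u = u := by
  funext t x
  simp

/-- Rescaling of data by `1` is the identity. [folklore] -/
@[simp]
theorem nsRescaleData_one (u₀ : E → F) : nsRescaleData 1 u₀ = u₀ := by
  funext x
  simp

/-- Rescaling of pressures by `1` is the identity. [folklore] -/
@[simp]
theorem nsRescalePressure_one (p : ℝ → E → ℝ) : nsRescalePressure 1 p = p := by
  funext t x
  simp

/-- Rescaling of forces by `1` is the identity. [folklore] -/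
@[simp]
theorem nsRescaleForce_one (f : ℝ → E → F) : nsRescaleForce 1 f = f := by
  funext t x
  simp

/-- The zero force is scale invariant. [folklore] -/
@[simp]
theorem nsRescaleForce_zero (c : ℝ) : nsRescaleForce c (0 : ℝ → E → F) = 0 := by
  funext t x
  simp

/-- **Group law** of the parabolic rescaling: `nsRescale (c * d) u = nsRescale d (nsRescale c u)`
(an action of the multiplicative monoid of `ℝ`; Leray 1934, §20). [cite: Leray1934, §20] -/
theorem nsRescale_mul (c d : ℝ) (u : ℝ → E → F) :
    nsRescale (c * d) u = nsRescale d (nsRescale c u) := by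
  funext t x
  simp only [nsRescale_apply, smul_smul, mul_comm d c]
  congr 2
  ring

/-- Group law of the rescaling of data: `nsRescaleData (c * d) u₀ = nsRescaleData d (nsRescaleData c u₀)`. [folklore] -/
theorem nsRescaleData_mul (c d : ℝ) (u₀ : E → F) :
    nsRescaleData (c * d) u₀ = nsRescaleData d (nsRescaleData c u₀) := by
  funext x
  simp only [nsRescaleData_apply, smul_smul, mul_comm d c]

/-- For `c ≠ 0`, rescaling by `c⁻¹` undoes rescaling by `c`. [folklore] -/
theorem nsRescale_inv_nsRescale {c : ℝ} (hc : c ≠ 0) (u : ℝ → E → F) :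
    nsRescale c⁻¹ (nsRescale c u) = u := by
  rw [← nsRescale_mul, mul_inv_cancel₀ hc, nsRescale_one]

end Rescale

/-! ### Self-similarity -/

section SelfSimilar

variable {E : Type*} [NormedAddCommGroup E] [NormedSpace ℝ E]
variable {F : Type*} [NormedAddCommGroup F] [NormedSpace ℝ F]

/-- `u : ℝ → E → F` is **self-similar** (scale invariant): `u_λ = u` for every `λ > 0`, i.e.
`λ u(λ²t, λx) = u(t, x)` (Leray 1934, (3.11); Nečas–Růžička–Šverák 1996, (1.3); forward
self-similar solutions: Jia–Šverák 2014). Meaningful on `ℝ × E`, on `(0, ∞) × E` and on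
`(-∞, 0) × E` alike, since the scaling preserves the sign of time. [cite: Leray1934, (3.11] -/
def IsSelfSimilar (u : ℝ → E → F) : Prop :=
  ∀ c : ℝ, 0 < c → nsRescale c u = u

/-- `u` is **discretely self-similar with factor `λ`** (`λ`-DSS): `u_λ = u` for this one `λ`
(typically `1 < λ`) (Tsai 2014; Chae–Wolf 2017, Def. 1.1 with `R = 1`;
Bradshaw–Tsai 2017, §1). [cite: Tsai2014] -/
def IsDiscretelySelfSimilar (c : ℝ) (u : ℝ → E → F) : Prop :=
  nsRescale c u = u

/-- `u : ℝ → E → E` is **rotated discretely self-similar** with factor `λ` and rotation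
`R ∈ O(E)` (Chae–Wolf 2017, Def. 1.1): `λ Rᵀ u(λ²t, λ R x) = u(t, x)` for all `t, x`. For
`R = 1` this is `IsDiscretelySelfSimilar` (`isRotatedDSS_refl_iff`). [cite: ChaeWolf2017, Def. 1.1] -/
def IsRotatedDSS (c : ℝ) (R : E ≃ₗᵢ[ℝ] E) (u : ℝ → E → E) : Prop :=
  ∀ t x, c • R.symm (u (c ^ 2 * t) (c • R x)) = u t x

omit [NormedSpace ℝ F] in
/-- A self-similar field is discretely self-similar with every positive factor. [folklore] -/
theorem IsSelfSimilar.isDiscretelySelfSimilar [NormedSpace ℝ F] {u : ℝ → E → F}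
    (h : IsSelfSimilar u) {c : ℝ} (hc : 0 < c) : IsDiscretelySelfSimilar c u :=
  h c hc

/-- Discrete self-similarity with factors `c` and `d` gives factor `c * d` (group law). [folklore] -/
theorem IsDiscretelySelfSimilar.mul {u : ℝ → E → F} {c d : ℝ} (hc : IsDiscretelySelfSimilar c u)
    (hd : IsDiscretelySelfSimilar d u) : IsDiscretelySelfSimilar (c * d) u := by
  unfold IsDiscretelySelfSimilar at *
  rw [nsRescale_mul, hc, hd]

/-- Rotated DSS with the trivial rotation is plain DSS (Chae–Wolf 2017, remark after Def. 1.1). [cite: ChaeWolf2017, remark after Def. 1.1] -/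
theorem isRotatedDSS_refl_iff {c : ℝ} {u : ℝ → E → E} :
    IsRotatedDSS c (LinearIsometryEquiv.refl ℝ E) u ↔ IsDiscretelySelfSimilar c u := by
  simp only [IsRotatedDSS, IsDiscretelySelfSimilar, funext_iff, nsRescale_apply]
  rfl

end SelfSimilar

/-! ### Leray's self-similar profiles -/

section Ansatz

variable {E : Type*} [NormedAddCommGroup E] [NormedSpace ℝ E]

/-- **Leray's backward self-similar ansatz** (Leray 1934, (3.11); Nečas–Růžička–Šverák 1996,
(1.3)): `lerayBackward a T U t x = (2a(T−t))^{-1/2} U((2a(T−t))^{-1/2} x)`, a putative solution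
blowing up at time `T` with rate parameter `a > 0`. **Junk value** for `t ≥ T` (or `a ≤ 0`):
`Real.sqrt` of a nonpositive number is `0` and `0⁻¹ = 0`, so the value is `0`. [cite: Leray1934, (3.11] -/
def lerayBackward (a T : ℝ) (U : E → E) : ℝ → E → E := fun t x =>
  (Real.sqrt (2 * a * (T - t)))⁻¹ • U ((Real.sqrt (2 * a * (T - t)))⁻¹ • x)

/-- The pressure of Leray's backward ansatz (Leray 1934, (3.11); NRŠ 1996, (1.3)):
`lerayBackwardPressure a T P t x = (2a(T−t))⁻¹ P((2a(T−t))^{-1/2} x)`. Junk (`= 0`) for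
`t ≥ T`. [cite: Leray1934, (3.11] -/
def lerayBackwardPressure (a T : ℝ) (P : E → ℝ) : ℝ → E → ℝ := fun t x =>
  (2 * a * (T - t))⁻¹ * P ((Real.sqrt (2 * a * (T - t)))⁻¹ • x)

/-- **Leray's forward (expanding) self-similar ansatz** (Leray 1934, (3.13); Jia–Šverák 2014,
(1.4)): `lerayForward a U t x = (2at)^{-1/2} U((2at)^{-1/2} x)` for `t > 0`. **Junk value** `0`
for `t ≤ 0` (as for `lerayBackward`). [cite: Leray1934, (3.13] -/
def lerayForward (a : ℝ) (U : E → E) : ℝ → E → E := fun t x =>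
  (Real.sqrt (2 * a * t))⁻¹ • U ((Real.sqrt (2 * a * t))⁻¹ • x)

/-- The pressure of the forward ansatz: `lerayForwardPressure a P t x = (2at)⁻¹ P((2at)^{-1/2} x)`
(Leray 1934, (3.13)). Junk (`= 0`) for `t ≤ 0`. [cite: Leray1934, (3.13] -/
def lerayForwardPressure (a : ℝ) (P : E → ℝ) : ℝ → E → ℝ := fun t x =>
  (2 * a * t)⁻¹ * P ((Real.sqrt (2 * a * t))⁻¹ • x)

/-- Unfolding `lerayBackward` (Leray 1934, (3.11)). [cite: Leray1934, (3.11] -/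
@[simp]
theorem lerayBackward_apply (a T : ℝ) (U : E → E) (t : ℝ) (x : E) :
    lerayBackward a T U t x =
      (Real.sqrt (2 * a * (T - t)))⁻¹ • U ((Real.sqrt (2 * a * (T - t)))⁻¹ • x) :=
  rfl

/-- Unfolding `lerayForward` (Leray 1934, (3.13)). [cite: Leray1934, (3.13] -/
@[simp]
theorem lerayForward_apply (a : ℝ) (U : E → E) (t : ℝ) (x : E) :
    lerayForward a U t x = (Real.sqrt (2 * a * t))⁻¹ • U ((Real.sqrt (2 * a * t))⁻¹ • x) :=
  rfl

/-- The backward ansatz is the time-reflected forward ansatz: `lerayBackward a T U t =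
lerayForward a U (T - t)` (definitional). [folklore] -/
theorem lerayBackward_eq_lerayForward (a T : ℝ) (U : E → E) (t : ℝ) :
    lerayBackward a T U t = lerayForward a U (T - t) :=
  rfl

/-- At the normalised time `t = T - (2a)⁻¹` the backward ansatz is the profile itself. [folklore] -/
theorem lerayBackward_apply_sub_inv {a : ℝ} (ha : 0 < a) (T : ℝ) (U : E → E) :
    lerayBackward a T U (T - (2 * a)⁻¹) = U := by
  funext x
  have h2a : (2 * a) ≠ 0 := by positivity
  have h1 : Real.sqrt (2 * a * (T - (T - (2 * a)⁻¹))) = 1 := by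
    rw [sub_sub_cancel, mul_inv_cancel₀ h2a, Real.sqrt_one]
  simp only [lerayBackward_apply, h1, inv_one, one_smul]

/-- At the normalised time `t = (2a)⁻¹` the forward ansatz is the profile itself. [folklore] -/
theorem lerayForward_apply_inv {a : ℝ} (ha : 0 < a) (U : E → E) :
    lerayForward a U (2 * a)⁻¹ = U := by
  funext x
  have h2a : (2 * a) ≠ 0 := by positivity
  have h1 : Real.sqrt (2 * a * (2 * a)⁻¹) = 1 := by
    rw [mul_inv_cancel₀ h2a, Real.sqrt_one]
  simp only [lerayForward_apply, h1, inv_one, one_smul]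

/-- A forward self-similar field on `(0, ∞)` is Leray's forward ansatz of its own time slice at
`t = (2a)⁻¹`: `u t = lerayForward a (u (2a)⁻¹) t` for `0 < t` (take `λ = (2at)^{-1/2}` in the
definition of self-similarity; Leray 1934, (3.13); Jia–Šverák 2014, (1.4)). [cite: Leray1934, (3.13] -/
theorem IsSelfSimilar.eq_lerayForward {u : ℝ → E → E} (h : IsSelfSimilar u) {a : ℝ} (ha : 0 < a)
    {t : ℝ} (ht : 0 < t) : u t = lerayForward a (u (2 * a)⁻¹) t := by
  have h2at : (0 : ℝ) < 2 * a * t := by positivity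
  have hs : 0 < Real.sqrt (2 * a * t) := Real.sqrt_pos.2 h2at
  have key := congr_fun (congr_fun (h _ (inv_pos.2 hs)) t)
  have ht' : t ≠ 0 := ht.ne'
  funext x
  rw [← key x, nsRescale_apply, lerayForward_apply]
  congr 2
  rw [inv_pow, Real.sq_sqrt h2at.le]
  field_simp

/-- A backward self-similar field is Leray's backward ansatz (with `T = 0`) of its time slice at
`t = -(2a)⁻¹`: `u t = lerayBackward a 0 (u (-(2a)⁻¹)) t` for `t < 0` (Leray 1934, (3.11);
NRŠ 1996, (1.3)). [cite: Leray1934, (3.11] -/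
theorem IsSelfSimilar.eq_lerayBackward {u : ℝ → E → E} (h : IsSelfSimilar u) {a : ℝ} (ha : 0 < a)
    {t : ℝ} (ht : t < 0) : u t = lerayBackward a 0 (u (-(2 * a)⁻¹)) t := by
  have h2at : (0 : ℝ) < 2 * a * (0 - t) := by nlinarith
  have hs : 0 < Real.sqrt (2 * a * (0 - t)) := Real.sqrt_pos.2 h2at
  have key := congr_fun (congr_fun (h _ (inv_pos.2 hs)) t)
  have ht' : t ≠ 0 := ht.ne
  funext x
  rw [← key x, nsRescale_apply, lerayBackward_apply]
  congr 2
  rw [inv_pow, Real.sq_sqrt h2at.le]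
  field_simp
  ring

/-- Leray's backward ansatz with `T = 0` is self-similar: `lerayBackward a 0 U` is invariant under
`nsRescale c`, `0 < c` (NRŠ 1996, (1.3)). [folklore] -/
theorem isSelfSimilar_lerayBackward_zero (a : ℝ) (U : E → E) :
    IsSelfSimilar (lerayBackward a 0 U) := by
  intro c hc
  funext t x
  have hsq : Real.sqrt (2 * a * (0 - c ^ 2 * t)) = c * Real.sqrt (2 * a * (0 - t)) := by
    rw [show 2 * a * (0 - c ^ 2 * t) = c ^ 2 * (2 * a * (0 - t)) by ring,
      Real.sqrt_mul (sq_nonneg c), Real.sqrt_sq hc.le]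
  have hc' : c ≠ 0 := hc.ne'
  have e1 : c * (c * Real.sqrt (2 * a * (0 - t)))⁻¹ = (Real.sqrt (2 * a * (0 - t)))⁻¹ := by
    rw [mul_inv, mul_inv_cancel_left₀ hc']
  have e2 : (c * Real.sqrt (2 * a * (0 - t)))⁻¹ * c = (Real.sqrt (2 * a * (0 - t)))⁻¹ := by
    rw [mul_inv, mul_comm, ← mul_assoc, mul_inv_cancel₀ hc', one_mul]
  simp only [nsRescale_apply, lerayBackward_apply]
  rw [hsq, smul_smul, smul_smul, e1, e2]

/-- Leray's forward ansatz is self-similar: `lerayForward a U` is invariant under `nsRescale c`,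
`0 < c` (Jia–Šverák 2014, (1.4)). [folklore] -/
theorem isSelfSimilar_lerayForward (a : ℝ) (U : E → E) : IsSelfSimilar (lerayForward a U) := by
  intro c hc
  funext t x
  have hsq : Real.sqrt (2 * a * (c ^ 2 * t)) = c * Real.sqrt (2 * a * t) := by
    rw [show 2 * a * (c ^ 2 * t) = c ^ 2 * (2 * a * t) by ring,
      Real.sqrt_mul (sq_nonneg c), Real.sqrt_sq hc.le]
  have hc' : c ≠ 0 := hc.ne'
  have e1 : c * (c * Real.sqrt (2 * a * t))⁻¹ = (Real.sqrt (2 * a * t))⁻¹ := by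
    rw [mul_inv, mul_inv_cancel_left₀ hc']
  have e2 : (c * Real.sqrt (2 * a * t))⁻¹ * c = (Real.sqrt (2 * a * t))⁻¹ := by
    rw [mul_inv, mul_comm, ← mul_assoc, mul_inv_cancel₀ hc', one_mul]
  simp only [nsRescale_apply, lerayForward_apply]
  rw [hsq, smul_smul, smul_smul, e1, e2]

end Ansatz

section Profiles

variable {E : Type*} [NormedAddCommGroup E] [InnerProductSpace ℝ E] [FiniteDimensional ℝ E]

/-- **Leray's profile system** (Leray 1934, (3.12); Nečas–Růžička–Šverák 1996, (1.4)–(1.5);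
Tsai 1998, (1.4)): `(U, P)` is a backward self-similar profile with viscosity `ν` and rate `a` if
`U ∈ C²`, `P ∈ C¹` and, pointwise on `E`,
`−νΔU + aU + a(y·∇)U + (U·∇)U + ∇P = 0`, `div U = 0`.
Then `lerayBackward a T U` solves Navier–Stokes on `(-∞, T) × E` with pressure
`lerayBackwardPressure a T P` (`lerayBackward_isClassical_iff`). Here `(y·∇)U (y) = DU(y)[y] =
fderiv ℝ U y y` and `(U·∇)U = convect U U`. [cite: Leray1934, (3.12] -/
structure IsLerayProfile (ν a : ℝ) (U : E → E) (P : E → ℝ) : Prop where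
  /-- The velocity profile is `C²`. -/
  contDiff_velocity : ContDiff ℝ 2 U
  /-- The pressure profile is `C¹`. -/
  contDiff_pressure : ContDiff ℝ 1 P
  /-- The profile equation `−νΔU + aU + a(y·∇)U + (U·∇)U + ∇P = 0` (NRŠ 1996, (1.4)). -/
  profile_eq : ∀ y,
    -(ν • (Δ U) y) + a • U y + a • fderiv ℝ U y y + convect U U y + gradient P y = 0
  /-- Incompressibility `div U = 0` (NRŠ 1996, (1.5)). -/
  divFree : VectorCalculus.IsDivFree U

/-- The **forward profile system** (Leray 1934, (3.14); Jia–Šverák 2014, (1.5)): `U ∈ C²`,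
`P ∈ C¹` and `−νΔU − aU − a(y·∇)U + (U·∇)U + ∇P = 0`, `div U = 0`; then `lerayForward a U`
solves Navier–Stokes on `(0, ∞) × E`. [cite: Leray1934, (3.14] -/
structure IsForwardProfile (ν a : ℝ) (U : E → E) (P : E → ℝ) : Prop where
  /-- The velocity profile is `C²`. -/
  contDiff_velocity : ContDiff ℝ 2 U
  /-- The pressure profile is `C¹`. -/
  contDiff_pressure : ContDiff ℝ 1 P
  /-- The profile equation `−νΔU − aU − a(y·∇)U + (U·∇)U + ∇P = 0` (Leray 1934, (3.14)). -/
  profile_eq : ∀ y,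
    -(ν • (Δ U) y) - a • U y - a • fderiv ℝ U y y + convect U U y + gradient P y = 0
  /-- Incompressibility `div U = 0`. -/
  divFree : VectorCalculus.IsDivFree U

/-- The trivial profile `U = 0`, `P = 0` (the only one in `L³(ℝ³)`, NRŠ 1996, Thm. 1). [folklore] -/
theorem IsLerayProfile.zero (ν a : ℝ) : IsLerayProfile ν a (0 : E → E) (0 : E → ℝ) where
  contDiff_velocity := contDiff_const
  contDiff_pressure := contDiff_const
  profile_eq y := by
    simp [convect, Pi.zero_def, gradient]
  divFree y := by simp [VectorCalculus.divergence, Pi.zero_def]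

/-- **Leray's reduction** (Leray 1934, §20, (3.11)–(3.12); NRŠ 1996, (1.3)–(1.5)): for smooth
profiles `U`, `P` and `0 < a`, the backward ansatz `(lerayBackward a T U, lerayBackwardPressure a T P)`
is a classical (unforced) Navier–Stokes solution on `(-∞, T) × E` if and only if `(U, P)` solves
the profile system. (Chain rule: with `λ(t) = (2a(T−t))^{-1/2}`, `λ' = aλ³`, every term of the
equation for `u = λ U(λ·)` is `λ³` times the corresponding profile term at `y = λx`; conversely
evaluate at `t = T − (2a)⁻¹`, where `λ = 1`.) [cite: Leray1934, §20  (3.11] -/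
def lerayBackward_isClassical_iff : Prop :=
  ∀ {ν a T : ℝ} (ha : 0 < a) {U : E → E} {P : E → ℝ} (hU : ContDiff ℝ ∞ U) (hP : ContDiff ℝ ∞ P),
    IsClassicalNSSolutionOn (Iio T) ν 0 (lerayBackward a T U) (lerayBackwardPressure a T P) ↔
      IsLerayProfile ν a U P

/-- Forward twin of `lerayBackward_isClassical_iff` (Leray 1934, (3.13)–(3.14)): for smooth
profiles and `0 < a`, `(lerayForward a U, lerayForwardPressure a P)` is a classical unforced
Navier–Stokes solution on `(0, ∞) × E` iff `(U, P)` is a forward profile. [cite: Leray1934, (3.13] -/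
def lerayForward_isClassical_iff : Prop :=
  ∀ {ν a : ℝ} (ha : 0 < a) {U : E → E} {P : E → ℝ} (hU : ContDiff ℝ ∞ U) (hP : ContDiff ℝ ∞ P),
    IsClassicalNSSolutionOn (Ioi 0) ν 0 (lerayForward a U) (lerayForwardPressure a P) ↔
      IsForwardProfile ν a U P

end Profiles

/-! ### Type I bounds -/

section TypeI

variable {X : Type*} {E : Type*} [NormedAddCommGroup E]
variable {F : Type*} [NormedAddCommGroup F]

/-- **Type I (scale-invariant) space–time decay** on `(-∞, 0) × E` with constant `C`
(Koch–Nadirashvili–Seregin–Šverák 2009, (1.6); Seregin–Šverák 2009, (1.4)):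
`‖u(t, x)‖ ≤ C / (‖x‖ + √(−t))` for all `t < 0` and `x`. The denominator is positive for
`t < 0`. [folklore] -/
def HasTypeIDecay (C : ℝ) (u : ℝ → E → F) : Prop :=
  ∀ t < 0, ∀ x, ‖u t x‖ ≤ C / (‖x‖ + Real.sqrt (-t))

/-- **Type I decay in time** on `(-∞, 0) × X` with constant `C` (KNSS 2009, (1.4);
Seregin–Šverák 2009, (1.3)): `‖u(t, x)‖ ≤ C / √(−t)` for all `t < 0` and `x`. [cite: KNSS2009, (1.4] -/
def HasTypeITimeDecay (C : ℝ) (u : ℝ → X → F) : Prop :=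
  ∀ t < 0, ∀ x, ‖u t x‖ ≤ C / Real.sqrt (-t)

/-- Space–time Type I decay implies Type I decay in time (drop `‖x‖ ≥ 0` in the denominator);
needs `0 ≤ C`. [folklore] -/
theorem HasTypeIDecay.hasTypeITimeDecay {C : ℝ} (hC : 0 ≤ C) {u : ℝ → E → F}
    (h : HasTypeIDecay C u) : HasTypeITimeDecay C u := by
  intro t ht x
  refine (h t ht x).trans ?_
  have hs : 0 < Real.sqrt (-t) := Real.sqrt_pos.2 (by linarith)
  exact div_le_div_of_nonneg_left hC hs (le_add_of_nonneg_left (norm_nonneg _))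

/-- Type I decay in time gives boundedness on every `(-∞, -δ)`, `0 < δ`. [folklore] -/
theorem HasTypeITimeDecay.isBoundedOn {C : ℝ} {u : ℝ → X → F} (h : HasTypeITimeDecay C u)
    (hC : 0 ≤ C) {δ : ℝ} (hδ : 0 < δ) : IsBoundedOn (Iio (-δ)) u := by
  refine ⟨C / Real.sqrt δ, fun t ht x => (h t (by simp only [mem_Iio] at ht; linarith) x).trans ?_⟩
  simp only [mem_Iio] at ht
  exact div_le_div_of_nonneg_left hC (Real.sqrt_pos.2 hδ)
    (Real.sqrt_le_sqrt (by linarith))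

variable [NormedSpace ℝ E] [NormedSpace ℝ F]

/-- The Type I space–time bound is **scale invariant**: `HasTypeIDecay C u → HasTypeIDecay C u_λ`
for `0 < λ` (KNSS 2009, §1: `(1.6)` is invariant under the Navier–Stokes scaling). [cite: KNSS2009, §1:  (1.6] -/
theorem HasTypeIDecay.nsRescale {C : ℝ} {u : ℝ → E → F} (h : HasTypeIDecay C u) {c : ℝ}
    (hc : 0 < c) : HasTypeIDecay C (nsRescale c u) := by
  intro t ht x
  have hct : c ^ 2 * t < 0 := mul_neg_of_pos_of_neg (by positivity) ht
  have key := h (c ^ 2 * t) hct (c • x)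
  rw [nsRescale_apply, norm_smul, Real.norm_of_nonneg hc.le]
  have hsq : Real.sqrt (-(c ^ 2 * t)) = c * Real.sqrt (-t) := by
    rw [show -(c ^ 2 * t) = c ^ 2 * -t by ring, Real.sqrt_mul (sq_nonneg c), Real.sqrt_sq hc.le]
  rw [norm_smul, Real.norm_of_nonneg hc.le, hsq, ← mul_add, div_mul_eq_div_div_swap] at key
  have hden : 0 < ‖x‖ + Real.sqrt (-t) :=
    add_pos_of_nonneg_of_pos (norm_nonneg _) (Real.sqrt_pos.2 (by linarith))
  calc c * ‖u (c ^ 2 * t) (c • x)‖ ≤ c * (C / (‖x‖ + Real.sqrt (-t)) / c) := by gcongr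
    _ = C / (‖x‖ + Real.sqrt (-t)) := by field_simp

/-- The Type I time bound is scale invariant (KNSS 2009, §1). [cite: KNSS2009, §1] -/
theorem HasTypeITimeDecay.nsRescale {C : ℝ} {u : ℝ → E → F} (h : HasTypeITimeDecay C u) {c : ℝ}
    (hc : 0 < c) : HasTypeITimeDecay C (nsRescale c u) := by
  intro t ht x
  have hct : c ^ 2 * t < 0 := mul_neg_of_pos_of_neg (by positivity) ht
  have key := h (c ^ 2 * t) hct (c • x)
  rw [nsRescale_apply, norm_smul, Real.norm_of_nonneg hc.le]
  have hsq : Real.sqrt (-(c ^ 2 * t)) = c * Real.sqrt (-t) := by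
    rw [show -(c ^ 2 * t) = c ^ 2 * -t by ring, Real.sqrt_mul (sq_nonneg c), Real.sqrt_sq hc.le]
  rw [hsq, div_mul_eq_div_div_swap] at key
  have hden : 0 < Real.sqrt (-t) := Real.sqrt_pos.2 (by linarith)
  calc c * ‖u (c ^ 2 * t) (c • x)‖ ≤ c * (C / Real.sqrt (-t) / c) := by gcongr
    _ = C / Real.sqrt (-t) := by field_simp

end TypeI

/-! ### Scaling of solutions; ancient mild solutions -/

section Solutions

variable {E : Type*} [NormedAddCommGroup E] [InnerProductSpace ℝ E] [FiniteDimensional ℝ E]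

/-- **Scale invariance of classical solutions** (Leray 1934, §20; Caffarelli–Kohn–Nirenberg 1982,
(1.5)–(1.6)): if `(u, p)` is a classical Navier–Stokes solution with force `f` on the time set
`S`, then for `0 < c` the rescaled pair `(nsRescale c u, nsRescalePressure c p)` is a classical
solution with force `nsRescaleForce c f` and the *same* viscosity on the rescaled time set
`c⁻² S = (c² · ) ⁻¹' S`. (Every term of the equation picks up the factor `c³` at `(c²t, cx)`.) [cite: Leray1934, §20] -/
def IsClassicalNSSolutionOn.nsRescale : Prop :=
  ∀ {S : Set ℝ} {ν : ℝ} {f u : ℝ → E → E} {p : ℝ → E → ℝ} (h : IsClassicalNSSolutionOn S ν f u p) {c : ℝ} (hc : 0 < c),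
    IsClassicalNSSolutionOn ((fun t => c ^ 2 * t) ⁻¹' S) ν (nsRescaleForce c f) (FluidPDE.nsRescale c u)
      (nsRescalePressure c p)

variable [MeasurableSpace E] [BorelSpace E]

/-- **Scale invariance of the two-time duality identity** (mild solutions; Kato 1984, §1;
Lemarié-Rieusset 2002, Ch. 11): if `u` is a mild solution between `s` and `t` with force `f`,
then `nsRescale c u` is a mild solution between `c⁻² s` and `c⁻² t` with force
`nsRescaleForce c f`, `0 < c`, `0 < ν`. (Change variables `x ↦ cx`, `τ ↦ c²τ`: the field
`x ↦ φ(x / c)` is again a smooth compactly supported divergence-free test field, and the heat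
flow is scale covariant, `e^{ντΔ}(φ(·/c)) = (e^{ν c⁻² τΔ}φ)(·/c)`.) [cite: Kato1984, §1] -/
def IsMildNSSolutionBetween.nsRescale : Prop :=
  ∀ {ν : ℝ} {f u : ℝ → E → E} {s t : ℝ} (h : IsMildNSSolutionBetween ν f u s t) (hν : 0 < ν) {c : ℝ} (hc : 0 < c),
    IsMildNSSolutionBetween ν (nsRescaleForce c f) (FluidPDE.nsRescale c u) (s / c ^ 2) (t / c ^ 2)

/-- **Scale invariance of Leray–Hopf solutions** (Leray 1934, §20; Caffarelli–Kohn–Nirenberg 1982,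
§1): if `u` is a Leray–Hopf weak solution on `[0, T)` with force `f` and datum `u₀`, then for
`0 < c`, `nsRescale c u` is a Leray–Hopf weak solution on `[0, c⁻² T)` with force
`nsRescaleForce c f` and datum `nsRescaleData c u₀` (all terms of the energy inequality scale by
the common factor `c^{2-n}`, `n = dim E`; the weak gradient rescales to `c² G(c²t, cx)`). [cite: Leray1934, §20] -/
def IsLerayHopfOn.nsRescale : Prop :=
  ∀ {T ν : ℝ} {f u : ℝ → E → E} {u₀ : E → E} (h : IsLerayHopfOn T ν f u₀ u) {c : ℝ} (hc : 0 < c),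
    IsLerayHopfOn (T / c ^ 2) ν (nsRescaleForce c f) (nsRescaleData c u₀) (FluidPDE.nsRescale c u)

omit [InnerProductSpace ℝ E] [FiniteDimensional ℝ E] [BorelSpace E] in
/-- **Scaling of `L^p` norms of data**: on an `n`-dimensional space,
`‖nsRescaleData c u₀‖_{L^p} = c^{1 - n/p} ‖u₀‖_{L^p}` for `0 < c`, `0 < p < ∞`
(Kato 1984, §1; the Jacobian of `x ↦ cx` is `c^{-n}`, Mathlib
`MeasureTheory.Measure.addHaar_smul`). [cite: Kato1984, §1] -/
def eLpNorm_nsRescaleData {F : Type*} [NormedAddCommGroup F] [NormedSpace ℝ F] : Prop :=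
  ∀ [NormedSpace ℝ E] [FiniteDimensional ℝ E] [BorelSpace E] {μ : Measure E} [μ.IsAddHaarMeasure] (u₀ : E → F) {c : ℝ} (hc : 0 < c) {p : ℝ≥0∞} (hp : p ≠ 0) (hp' : p ≠ ⊤),
    eLpNorm (nsRescaleData c u₀) p μ =
      ENNReal.ofReal (c ^ (1 - (Module.finrank ℝ E : ℝ) / p.toReal)) * eLpNorm u₀ p μ

/-- **`L³` is scale invariant in dimension three** (Kato 1984, §1; the critical space of
Escauriaza–Seregin–Šverák 2003): if `finrank ℝ E = 3` then
`‖nsRescaleData c u₀‖_{L³} = ‖u₀‖_{L³}` for every `0 < c`; the general scaling law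
`eLpNorm_nsRescaleData` is the hypothesis `hscale`. [cite: Kato1984, §1] -/
theorem eLpNorm_nsRescaleData_three (hE : Module.finrank ℝ E = 3)
    {F : Type*} [NormedAddCommGroup F] [NormedSpace ℝ F] (hscale : eLpNorm_nsRescaleData (E := E) (F := F))
    (u₀ : E → F) {c : ℝ} (hc : 0 < c) :
    eLpNorm (nsRescaleData c u₀) 3 volume = eLpNorm u₀ 3 (volume : Measure E) := by
  have h := hscale (μ := (volume : Measure E)) u₀ hc
    (p := 3) (by norm_num) (by norm_num)
  norm_num [hE] at h
  exact h

/-- **Time-translation invariance of the two-time duality identity**: if the identity holds for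
`(u, f)` between `a + s` and `b + s`, it holds for the translates `u (· + s)`, `f (· + s)`
between `a` and `b` (the identity is autonomous; Mathlib `intervalIntegral.integral_comp_add_right`).
[folklore] -/
theorem IsMildNSSolutionBetween.comp_add_right {ν : ℝ} {f u : ℝ → E → E} {a b s : ℝ}
    (h : IsMildNSSolutionBetween ν f u (a + s) (b + s)) :
    IsMildNSSolutionBetween ν (fun τ => f (τ + s)) (fun τ => u (τ + s)) a b := by
  intro φ hφ hdiv
  have key := h φ hφ hdiv
  rw [← intervalIntegral.integral_comp_add_right, ← intervalIntegral.integral_comp_add_right,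
    add_sub_add_right_eq_sub] at key
  simpa only [add_sub_add_right_eq_sub] using key

/-- Unforced case of `IsMildNSSolutionBetween.comp_add_right` (the zero force is translation
invariant, definitionally). [folklore] -/
theorem IsMildNSSolutionBetween.comp_add_right_zero {ν : ℝ} {u : ℝ → E → E} {a b s : ℝ}
    (h : IsMildNSSolutionBetween ν 0 u (a + s) (b + s)) :
    IsMildNSSolutionBetween ν 0 (fun τ => u (τ + s)) a b :=
  h.comp_add_right

/-! #### Ancient mild solutions -/

/-- **Ancient mild solutions** on `(-∞, 0) × E` (Koch–Nadirashvili–Seregin–Šverák 2009, §1,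
(1.3); Seregin–Šverák 2009, Def. 1.1): every slice `u t`, `t < 0`, is weakly divergence free,
and the unforced two-time duality (mild) identity holds between all `s < t < 0`. The literature
takes `u` bounded (`IsBoundedAncientMildSolution`); intended for `0 < ν`. [folklore] -/
def IsAncientMildSolution (ν : ℝ) (u : ℝ → E → E) : Prop :=
  (∀ t < 0, IsWeaklyDivFree (u t)) ∧ ∀ s t : ℝ, s < t → t < 0 → IsMildNSSolutionBetween ν 0 u s t

/-- **Bounded ancient mild solutions** (KNSS 2009, §1: "bounded mild ancient solutions", the
objects of the Liouville conjecture): ancient mild solutions in `L^∞((-∞, 0) × E)`. [cite: KNSS2009, §1: "bounded mild ancient solutions"  th] -/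
def IsBoundedAncientMildSolution (ν : ℝ) (u : ℝ → E → E) : Prop :=
  IsAncientMildSolution ν u ∧ IsBoundedOn (Iio 0) u

variable {ν : ℝ} {u : ℝ → E → E}

/-- A bounded ancient mild solution is an ancient mild solution (projection). [folklore] -/
theorem IsBoundedAncientMildSolution.isAncientMildSolution (h : IsBoundedAncientMildSolution ν u) :
    IsAncientMildSolution ν u :=
  h.1

/-- A bounded ancient mild solution is bounded on `(-∞, 0)` (projection). [folklore] -/
theorem IsBoundedAncientMildSolution.isBoundedOn (h : IsBoundedAncientMildSolution ν u) :
    IsBoundedOn (Iio 0) u :=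
  h.2

/-- Constants are bounded ancient mild solutions (KNSS 2009, §1: the Liouville conjecture asserts
the converse in the bounded class). For a constant field every slice is divergence free, the
nonlinear term pairs to `∫ ⟪b, (b·∇)ψ⟫ = 0`, and `∫ ⟪b, e^{τΔ}φ⟫ = ∫ ⟪b, φ⟫` (the heat flow
preserves the integral). [cite: KNSS2009, §1: the Liouville conjecture asserts the] -/
def isBoundedAncientMildSolution_const : Prop :=
  ∀ (hν : 0 < ν) (b : E),
    IsBoundedAncientMildSolution ν (fun _ _ => b)

/-- **Scale invariance of ancient mild solutions** (KNSS 2009, §1): `u ↦ nsRescale c u`, `0 < c`,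
preserves `IsAncientMildSolution ν` (the scaling maps `(-∞, 0)` onto itself;
`IsMildNSSolutionBetween.nsRescale`). [cite: KNSS2009, §1] -/
def IsAncientMildSolution.nsRescale : Prop :=
  ∀ (h : IsAncientMildSolution ν u) (hν : 0 < ν) {c : ℝ} (hc : 0 < c),
    IsAncientMildSolution ν (FluidPDE.nsRescale c u)

/-- Bounded ancient mild solutions are scale invariant, with bound `c · C` (KNSS 2009, §1); scale
invariance of ancient mild solutions `IsAncientMildSolution.nsRescale` is the hypothesis `hr`. [cite: KNSS2009, §1] -/
theorem IsBoundedAncientMildSolution.nsRescale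
    (hr : IsAncientMildSolution.nsRescale (ν := ν) (u := u))
    (h : IsBoundedAncientMildSolution ν u) (hν : 0 < ν)
    {c : ℝ} (hc : 0 < c) : IsBoundedAncientMildSolution ν (nsRescale c u) := by
  refine ⟨hr h.1 hν hc, ?_⟩
  obtain ⟨C, hC⟩ := h.2
  refine ⟨c * C, fun t ht x => ?_⟩
  rw [nsRescale_apply, norm_smul, Real.norm_of_nonneg hc.le]
  exact mul_le_mul_of_nonneg_left
    (hC _ (by simpa using mul_neg_of_pos_of_neg (by positivity : (0 : ℝ) < c ^ 2) ht) _) hc.le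

/-- **Time-translation invariance of ancient mild solutions** (KNSS 2009, §1): for `s ≤ 0`,
`t ↦ u (t + s)` is again an ancient mild solution (translation by `s ≤ 0` maps `(-∞, 0)` into
itself, and the duality identity is autonomous for the zero force). [cite: KNSS2009, §1] -/
theorem IsAncientMildSolution.time_translate (h : IsAncientMildSolution ν u) {s : ℝ} (hs : s ≤ 0) :
    IsAncientMildSolution ν (fun t => u (t + s)) := by
  refine ⟨fun t ht => h.1 (t + s) (by linarith), fun a b hab hb => ?_⟩
  exact (h.2 (a + s) (b + s) (by linarith) (by linarith)).comp_add_right_zero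

/-- An ancient mild solution restricted to `[t₀, 0)` is a mild solution on `[0, -t₀)` after the
time shift `t ↦ u (t + t₀)`, with datum `u t₀` (KNSS 2009, §1). (Contentful for `t₀ < 0`; for
`0 ≤ t₀` the time set is empty.) [cite: KNSS2009, §1] -/
theorem IsAncientMildSolution.isMildNSSolutionOn_translate (h : IsAncientMildSolution ν u) (t₀ : ℝ) :
    IsMildNSSolutionOn (Ico 0 (-t₀)) ν 0 (u t₀) (fun t => u (t + t₀)) := by
  refine ⟨fun t ht => h.1 (t + t₀) (by linarith [ht.2]), fun t ht => ?_⟩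
  have key : IsMildNSSolutionBetween ν 0 (fun t => u (t + t₀)) 0 t := by
    rcases ht.1.eq_or_lt with rfl | ht0
    · exact IsMildNSSolutionBetween.refl _ _ _ _
    · exact (h.2 (0 + t₀) (t + t₀) (by linarith) (by linarith [ht.2])).comp_add_right_zero
  simpa using (isMildNSSolutionFrom_self_iff (u := fun t => u (t + t₀))).2 key

end Solutions

end Literature.Analysis.FluidPDE
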